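import Summits.CriticalPhenomena.CardyFormulaZ2.Theorems.CardyMagicRigidityNestingRigidityNeckZ2NecklaceCertificates
import Summits.CriticalPhenomena.CardyFormulaZ2.Theorems.CardyMagicRigidityNestingRigidityNeckZ2SkeletonCells
import HarnessLib

/-!
# Crux `NestingRigidity`, line `pinch-resampling` (v4), stub S12: node annuli of a necklace skeleton — crossings and disjointness

Crux `Summit.CriticalPhenomena.CardyFormulaZ2.Theses.CardyMagicRigidity.NestingRigidity`
(stmt-CriticalPhenomena-4835), line `pinch-resampling` v4, stub S12 `stub_neckHookupCoarseZ2 : NeckHookupCoarseZ2`.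
Brick of the summation of the necklace bound `ZNodeAbsBoundChainA` (amended plan in the module docstring of
`…NestingRigidityGapEntropy`, worker W6a): the NODE side of the hypotheses of the glued bound
`real_fourArm_and_armsIn_le` (`…NeckZ2NodeReimerRegion`), for the annuli computed from a cell skeleton
(`…NeckZ2SkeletonCells`) of a necklace (`…NeckZ2Necklace`, `…NeckZ2NecklaceCertificates`).

For a cell skeleton `S` (cut `a₀`, sorted rotated cells `t`) COMPATIBLE with the necklace `N` (the rotated cells of
the locales are exactly the `t m`), the index interval `[i, j]` (`i ≤ j < n`) with outer gap
`G = S.gapOutZ Groot i j` (in cells; `Groot` the root's conventional outer gap) has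
CENTRE `nodeCenter = x + idxPt (t i)`, INNER RADIUS `nodeRIn = (2 (t j - t i) + 3) ℓ` and OUTER RADIUS
`nodeROut = ℓ ⌊G / 8⌋`.

* §1 `Necklace.node_crossings` (registered anchor `necklace_node_annulus_crossings`): if the node is GOOD in the
  weak sense `2 (t j - t i) + 3 ≤ ⌊G/8⌋` and `nodeROut + 1 ≤ s`, the annulus carries the two crossings of the node
  certificate (clusters of `u i₁`, `u (j₁ + 1)` for the first run `[i₁, j₁]` of the hop indices whose rotated cell
  lies in `[t i, t j]`), by `cellSkeleton_isolation` + `Necklace.exists_node_crossings`; the annulus lies in `Λ_{2s}(x)`.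
* §2 `CellSkeleton.nodeAnnulus_disjoint`: the annuli of two distinct index intervals of a laminar pair (disjoint or
  nested, as the nodes of `GapHierarchy` are) with outer gaps `≥ 8` are DISJOINT — nested: the inner one sits in the
  inner disc of the outer one (`G_inner ≤ span_outer`); disjoint: the centres are `≥ (ℓ max G - 2ℓ + 1)/2` apart.
-/

noncomputable section

namespace Summit.CriticalPhenomena.CardyFormulaZ2.Cruxes.NestingRigidity.PinchResampling

open MeasureTheory Set Literature.Probability.Percolation Literature.Probability.LatticeModels
open ZPinchLocality
open NeckCoarseZ2

namespace NeckCoarseZ2.CellSkeleton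

variable {Nc : ℤ} (S : CellSkeleton Nc) (R ℓz : ℤ) (x : Site 2)

/-- **Centre** of the annulus of the index interval starting at `i`: the ring point of rotated cell `t i`. -/
def nodeCenter (i : ℕ) : Site 2 := x + idxPt R ℓz Nc S.a₀ (S.t i)

/-- **Inner radius** `(2 (t j - t i) + 3) ℓ` of the annulus of `[i, j]`. -/
def nodeRIn (ℓ : ℕ) (i j : ℕ) : ℕ := (2 * (S.t j - S.t i).toNat + 3) * ℓ

/-- **Outer radius** `ℓ ⌊G / 8⌋` of an annulus of outer gap `G` (cells). -/
def nodeROut (ℓ : ℕ) (G : ℤ) : ℕ := ℓ * (G / 8).toNat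

variable {S R ℓz x}

/-- The rotated cells reflect the order: `t m ≤ t m'` with `m, m' < n` forces `m ≤ m'`. -/
theorem le_of_t_le {m m' : ℕ} (hm : m < S.n) (h : S.t m ≤ S.t m') : m ≤ m' := by
  by_contra hcon
  exact absurd (S.t_strictMono (lt_of_not_ge hcon) hm) (not_lt.2 h)

/-! ## §2 Disjointness of node annuli -/

/-- **Annuli of distinct laminar index intervals with outer gaps `≥ 8` are disjoint.** -/
theorem nodeAnnulus_disjoint {ℓ : ℕ} (hℓ : 1 ≤ ℓ) (hℓz : ℓz = ℓ) (hR : 1 ≤ R) (hNc : 8 * R ≤ Nc * ℓz)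
    (hNc' : (Nc - 1) * ℓz < 8 * R) (Groot : ℤ) {i j i' j' : ℕ} (hij : i ≤ j) (hj : j < S.n) (hij' : i' ≤ j')
    (hj' : j' < S.n) (hne : (i, j) ≠ (i', j'))
    (hlam : (j < i' ∨ j' < i) ∨ (i ≤ i' ∧ j' ≤ j) ∨ (i' ≤ i ∧ j ≤ j'))
    (hG : 8 ≤ S.gapOutZ Groot i j) (hG' : 8 ≤ S.gapOutZ Groot i' j') :
    Disjoint (zAnn (S.nodeCenter R ℓz x i) (S.nodeRIn ℓ i j) (CellSkeleton.nodeROut ℓ (S.gapOutZ Groot i j)))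
      (zAnn (S.nodeCenter R ℓz x i') (S.nodeRIn ℓ i' j') (CellSkeleton.nodeROut ℓ (S.gapOutZ Groot i' j'))) := by
  subst hℓz
  have hℓ0 : (0 : ℤ) < ℓ := by exact_mod_cast hℓ
  set G := S.gapOutZ Groot i j with hGdef
  set G' := S.gapOutZ Groot i' j' with hG'def
  have hi : i < S.n := by omega
  have hi' : i' < S.n := by omega
  -- the two centres, as ring points of rotated cells `t i`, `t i'`
  have hc := zNorm_idxPt hℓ0 hNc' S.a₀_nonneg S.a₀_lt (S.t_nonneg hi) (S.t_lt i hi) (R := R)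
  have hc' := zNorm_idxPt hℓ0 hNc' S.a₀_nonneg S.a₀_lt (S.t_nonneg hi') (S.t_lt i' hi') (R := R)
  have hρ := rotIdx_cellIdx_idxPt hℓ0 hNc' S.a₀_nonneg S.a₀_lt (S.t_nonneg hi) (S.t_lt i hi) (R := R)
  have hρ' := rotIdx_cellIdx_idxPt hℓ0 hNc' S.a₀_nonneg S.a₀_lt (S.t_nonneg hi') (S.t_lt i' hi') (R := R)
  -- casts of the radii
  have hRIn : ∀ a b : ℕ, a ≤ b → b < S.n → ((S.nodeRIn ℓ a b : ℕ) : ℤ) = (2 * (S.t b - S.t a) + 3) * ℓ := by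
    intro a b hab hb
    have h0 : 0 ≤ S.t b - S.t a := by have := S.t_mono hab hb; omega
    simp only [nodeRIn]
    push_cast
    rw [Int.toNat_of_nonneg h0]
  have hROut : ∀ E : ℤ, 0 ≤ E → ((CellSkeleton.nodeROut ℓ E : ℕ) : ℤ) = ℓ * (E / 8) ∧ ℓ * (E / 8) * 8 ≤ ℓ * E := by
    intro E hE
    have h0 : 0 ≤ E / 8 := Int.ediv_nonneg hE (by norm_num)
    have h1 := Int.ediv_mul_le E (show (8 : ℤ) ≠ 0 by norm_num)
    refine ⟨?_, by nlinarith⟩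
    simp only [nodeROut]
    push_cast
    rw [Int.toNat_of_nonneg h0]
  obtain ⟨hRO, hRO8⟩ := hROut G (by omega)
  obtain ⟨hRO', hRO8'⟩ := hROut G' (by omega)
  rw [Set.disjoint_left]
  rintro y ⟨hy1, hy2⟩ ⟨hy1', hy2'⟩
  simp only [nodeCenter] at hy1 hy2 hy1' hy2'
  rw [hRO] at hy2
  rw [hRO'] at hy2'
  rw [hRIn i j hij hj] at hy1
  rw [hRIn i' j' hij' hj'] at hy1'
  set c := idxPt R (ℓ : ℤ) Nc S.a₀ (S.t i) with hcdef
  set c' := idxPt R (ℓ : ℤ) Nc S.a₀ (S.t i') with hc'def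
  -- distance between the centres, through `y`
  have hcc : zNorm (c - c') ≤ zNorm (y - (x + c)) + zNorm (y - (x + c')) := by
    have h := zNorm_sub_le_add (x + c) y (x + c')
    rw [zNorm_sub_comm (x + c) y, show x + c - (x + c') = c - c' by abel] at h
    exact h
  rcases hlam with hdisj | hnest
  · -- disjoint intervals: the centres are far apart
    have hsep := le_two_mul_zNorm_sub_of_rotIdx hℓ0 hR hNc hNc' hc hc' (a₀ := S.a₀)
    rw [hρ, hρ'] at hsep
    -- `max G G' ≤ |t i - t i'|` and `≤ Nc - |t i - t i'|`
    have hwrapG := (S.gapOutZ_le Groot hij (by omega) (fun h ↦ by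
      rcases hdisj with h' | h' <;> omega)).2.1
    have hwrapG' := (S.gapOutZ_le Groot hij' (by omega) (fun h ↦ by
      rcases hdisj with h' | h' <;> omega)).2.1
    have hΔ : G ≤ |S.t i - S.t i'| ∧ G' ≤ |S.t i - S.t i'| := by
      rcases hdisj with h' | h'
      · -- `[i, j] < [i', j']`
        have h1 := (S.gapOutZ_le Groot hij (by omega) (fun h ↦ by omega)).2.2.2 i' (by omega) hi'
        have h2 := (S.gapOutZ_le Groot hij' (by omega) (fun h ↦ by omega)).2.2.1 i (by omega)
        have h3 := S.t_mono (show i ≤ i' by omega) hi'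
        rw [abs_of_nonpos (by omega)]
        constructor <;> omega
      · have h1 := (S.gapOutZ_le Groot hij' (by omega) (fun h ↦ by omega)).2.2.2 i (by omega) hi
        have h2 := (S.gapOutZ_le Groot hij (by omega) (fun h ↦ by omega)).2.2.1 i' (by omega)
        have h3 := S.t_mono (show i' ≤ i by omega) hi
        rw [abs_of_nonneg (by omega)]
        constructor <;> omega
    have hΔ' : |S.t i - S.t i'| ≤ S.t (S.n - 1) := by
      have h1 := S.t_nonneg hi
      have h2 := S.t_nonneg hi'
      have h3 := S.t_le_last hi
      have h4 := S.t_le_last hi'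
      rw [abs_le]
      constructor <;> omega
    have key : (ℓ : ℤ) * max G G' ≤ min ((ℓ : ℤ) * |S.t i - S.t i'|) ((ℓ : ℤ) * (Nc - |S.t i - S.t i'|)) := by
      refine le_min (mul_le_mul_of_nonneg_left (max_le hΔ.1 hΔ.2) hℓ0.le)
        (mul_le_mul_of_nonneg_left (max_le (by omega) (by omega)) hℓ0.le)
    have hmax : (ℓ : ℤ) * G ≤ (ℓ : ℤ) * max G G' ∧ (ℓ : ℤ) * G' ≤ (ℓ : ℤ) * max G G' :=
      ⟨mul_le_mul_of_nonneg_left (le_max_left _ _) hℓ0.le, mul_le_mul_of_nonneg_left (le_max_right _ _) hℓ0.le⟩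
    nlinarith [hy2, hy2', hcc, hsep, key, hmax.1, hmax.2, hRO8, hRO8']
  · -- nested intervals: the inner annulus sits in the inner disc of the outer one
    have hclose := zNorm_sub_lt_of_rotIdx hℓ0 hR hNc hc hc' (a₀ := S.a₀)
    rw [hρ, hρ'] at hclose
    rcases hnest with ⟨h1, h2⟩ | ⟨h1, h2⟩
    · -- `[i', j'] ⊆ [i, j]`, strictly
      have hsub : G' ≤ S.t j - S.t i := by
        have hstrict : i < i' ∨ j' < j := by
          by_contra hh
          exact hne (by rw [show i = i' by omega, show j = j' by omega])
        rcases hstrict with hlt | hlt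
        · have := (S.gapOutZ_le Groot hij' (by omega) (fun h ↦ by omega)).2.2.1 i hlt
          have := S.t_mono h2 hj
          have := S.t_mono hij' hj'
          omega
        · have := (S.gapOutZ_le Groot hij' (by omega) (fun h ↦ by omega)).2.2.2 j hlt hj
          have := S.t_mono h1 hi'
          omega
      have hti : |S.t i - S.t i'| ≤ S.t j - S.t i := by
        have := S.t_mono h1 hi'
        have := S.t_mono (h2.trans' hij') hj
        have := S.t_mono hij' hj'
        rw [abs_of_nonpos (by omega)]
        omega
      -- `|y - c| ≥ rIn (i, j)` but `|y - c| ≤ |y - c'| + |c - c'| < ROut' + (Δ + 1) ℓ ≤ rIn`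
      have h3 := zNorm_sub_le_add y (x + c') (x + c)
      rw [show x + c' - (x + c) = c' - c by abel, zNorm_sub_comm c' c] at h3
      have h4 : (ℓ : ℤ) * |S.t i - S.t i'| ≤ (ℓ : ℤ) * (S.t j - S.t i) := mul_le_mul_of_nonneg_left hti hℓ0.le
      have h5 : (ℓ : ℤ) * G' ≤ (ℓ : ℤ) * (S.t j - S.t i) := mul_le_mul_of_nonneg_left hsub hℓ0.le
      have h6 : (2 * (S.t j - S.t i) + 3) * (ℓ : ℤ) = 2 * ((ℓ : ℤ) * (S.t j - S.t i)) + 3 * ℓ := by ring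
      have h7 : (|S.t i - S.t i'| + 1) * (ℓ : ℤ) = (ℓ : ℤ) * |S.t i - S.t i'| + ℓ := by ring
      rw [h6] at hy1
      rw [h7] at hclose
      have h8 : 0 ≤ (ℓ : ℤ) * (S.t j - S.t i) :=
        mul_nonneg hℓ0.le (by have := S.t_mono hij hj; omega)
      linarith
    · -- `[i, j] ⊆ [i', j']`, strictly
      have hsub : G ≤ S.t j' - S.t i' := by
        have hstrict : i' < i ∨ j < j' := by
          by_contra hh
          exact hne (by rw [show i = i' by omega, show j = j' by omega])
        rcases hstrict with hlt | hlt
        · have := (S.gapOutZ_le Groot hij (by omega) (fun h ↦ by omega)).2.2.1 i' hlt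
          have := S.t_mono h2 hj'
          have := S.t_mono hij hj
          omega
        · have := (S.gapOutZ_le Groot hij (by omega) (fun h ↦ by omega)).2.2.2 j' hlt hj'
          have := S.t_mono h1 hi
          omega
      have hti : |S.t i - S.t i'| ≤ S.t j' - S.t i' := by
        have := S.t_mono h1 hi
        have := S.t_mono (h2.trans' hij) hj'
        have := S.t_mono hij hj
        rw [abs_of_nonneg (by omega)]
        omega
      have h3 := zNorm_sub_le_add y (x + c) (x + c')
      rw [show x + c - (x + c') = c - c' by abel] at h3
      have h4 : (ℓ : ℤ) * |S.t i - S.t i'| ≤ (ℓ : ℤ) * (S.t j' - S.t i') := mul_le_mul_of_nonneg_left hti hℓ0.le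
      have h5 : (ℓ : ℤ) * G ≤ (ℓ : ℤ) * (S.t j' - S.t i') := mul_le_mul_of_nonneg_left hsub hℓ0.le
      have h6 : (2 * (S.t j' - S.t i') + 3) * (ℓ : ℤ) = 2 * ((ℓ : ℤ) * (S.t j' - S.t i')) + 3 * ℓ := by ring
      have h7 : (|S.t i - S.t i'| + 1) * (ℓ : ℤ) = (ℓ : ℤ) * |S.t i - S.t i'| + ℓ := by ring
      rw [h6] at hy1'
      rw [h7] at hclose
      have h8 : 0 ≤ (ℓ : ℤ) * (S.t j' - S.t i') :=
        mul_nonneg hℓ0.le (by have := S.t_mono hij' hj'; omega)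
      linarith

end NeckCoarseZ2.CellSkeleton

/-! ## §1 Crossings of the node annuli -/

namespace Necklace

variable {ω : BondConfig (Site 2)} {ℓ lam s : ℕ} {x : Site 2} (N : Necklace ω ℓ lam s x) {Nc : ℤ}
  (S : CellSkeleton Nc)

/-- **The annulus of a good node of a compatible cell skeleton carries the two crossings of the node certificate.**
Compatibility: the rotated cells of the locales are exactly the `t m`; goodness (weak form):
`2 (t j - t i) + 3 ≤ ⌊G/8⌋`; the outer radius stays `≤ s - 1`.  The crossing clusters are those of `u i₁` and
`u (j₁ + 1)` for the first run `[i₁, j₁]` of the hop indices whose rotated cell lies in `[t i, t j]`. -/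
theorem node_crossings (hHG : ∀ a b, (openGraph ω).Adj a b → (zdGraph 2).Adj a b) (hℓ : 1 ≤ ℓ)
    (hNc : 8 * ((s : ℤ) + 1) ≤ Nc * ℓ) (hNc' : (Nc - 1) * (ℓ : ℤ) < 8 * ((s : ℤ) + 1))
    (hcomp : ∀ a < N.k, ∃ m < S.n, rotIdx Nc S.a₀ (cellIdx ((s : ℤ) + 1) ℓ (N.p a - x)) = S.t m)
    (hcomp' : ∀ m < S.n, ∃ a < N.k, rotIdx Nc S.a₀ (cellIdx ((s : ℤ) + 1) ℓ (N.p a - x)) = S.t m)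
    (Groot : ℤ) {i j : ℕ} (hij : i ≤ j) (hj : j < S.n)
    (hgood : 2 * (S.t j - S.t i) + 3 ≤ S.gapOutZ Groot i j / 8)
    (hRs : (ℓ : ℤ) * (S.gapOutZ Groot i j / 8) + 1 ≤ s) :
    ∃ i₁ j₁ p₁ q₁ p₂ q₂, i₁ ≤ j₁ ∧ j₁ < N.k ∧
      (∀ a, i₁ ≤ a → a ≤ j₁ → S.t i ≤ rotIdx Nc S.a₀ (cellIdx ((s : ℤ) + 1) ℓ (N.p a - x)) ∧
        rotIdx Nc S.a₀ (cellIdx ((s : ℤ) + 1) ℓ (N.p a - x)) ≤ S.t j) ∧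
      (∀ a < i₁, ¬ (S.t i ≤ rotIdx Nc S.a₀ (cellIdx ((s : ℤ) + 1) ℓ (N.p a - x)) ∧
        rotIdx Nc S.a₀ (cellIdx ((s : ℤ) + 1) ℓ (N.p a - x)) ≤ S.t j)) ∧
      (j₁ + 1 < N.k → ¬ (S.t i ≤ rotIdx Nc S.a₀ (cellIdx ((s : ℤ) + 1) ℓ (N.p (j₁ + 1) - x)) ∧
        rotIdx Nc S.a₀ (cellIdx ((s : ℤ) + 1) ℓ (N.p (j₁ + 1) - x)) ≤ S.t j)) ∧
      zNorm (p₁ - S.nodeCenter ((s : ℤ) + 1) ℓ x i) = S.nodeRIn ℓ i j ∧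
      zNorm (q₁ - S.nodeCenter ((s : ℤ) + 1) ℓ x i) = CellSkeleton.nodeROut ℓ (S.gapOutZ Groot i j) ∧
      zNorm (p₂ - S.nodeCenter ((s : ℤ) + 1) ℓ x i) = S.nodeRIn ℓ i j ∧
      zNorm (q₂ - S.nodeCenter ((s : ℤ) + 1) ℓ x i) = CellSkeleton.nodeROut ℓ (S.gapOutZ Groot i j) ∧
      PathIn (openGraph ω) (zAnn (S.nodeCenter ((s : ℤ) + 1) ℓ x i) (S.nodeRIn ℓ i j)
        (CellSkeleton.nodeROut ℓ (S.gapOutZ Groot i j))) p₁ q₁ ∧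
      PathIn (openGraph ω) (zAnn (S.nodeCenter ((s : ℤ) + 1) ℓ x i) (S.nodeRIn ℓ i j)
        (CellSkeleton.nodeROut ℓ (S.gapOutZ Groot i j))) p₂ q₂ ∧
      ¬ PathIn (openGraph ω) (zAnn (S.nodeCenter ((s : ℤ) + 1) ℓ x i) (S.nodeRIn ℓ i j)
        (CellSkeleton.nodeROut ℓ (S.gapOutZ Groot i j))) p₁ p₂ ∧
      PathIn (openGraph ω) (zBall x (2 * s)) (N.u i₁) p₁ ∧
      PathIn (openGraph ω) (zBall x (2 * s)) (N.u (j₁ + 1)) p₂ := by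
  have hℓ0 : (0 : ℤ) < ℓ := by exact_mod_cast hℓ
  have hR : (1 : ℤ) ≤ (s : ℤ) + 1 := by omega
  set G := S.gapOutZ Groot i j with hGdef
  have hi : i < S.n := by omega
  have hΔ0 : 0 ≤ S.t j - S.t i := by have := S.t_mono hij hj; omega
  have hG8 : 0 ≤ G / 8 := by omega
  have hG0 : 0 ≤ G := by
    by_contra h
    have : G / 8 < 0 := Int.ediv_neg_of_neg_of_pos (by omega) (by norm_num)
    omega
  -- casts of the radii and the centre
  have hrIn : ((S.nodeRIn ℓ i j : ℕ) : ℤ) = (2 * (S.t j - S.t i) + 3) * ℓ := by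
    simp only [CellSkeleton.nodeRIn]; push_cast; rw [Int.toNat_of_nonneg hΔ0]
  have hrOut : ((CellSkeleton.nodeROut ℓ G : ℕ) : ℤ) = ℓ * (G / 8) := by
    simp only [CellSkeleton.nodeROut]; push_cast; rw [Int.toNat_of_nonneg hG8]
  have hrOut8 : (ℓ : ℤ) * (G / 8) * 8 ≤ ℓ * G := by
    have h1 := Int.ediv_mul_le G (show (8 : ℤ) ≠ 0 by norm_num)
    nlinarith
  have hw : zNorm (S.nodeCenter ((s : ℤ) + 1) ℓ x i - x) ≤ s + 1 := by
    simp only [CellSkeleton.nodeCenter, add_sub_cancel_left]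
    exact (zNorm_idxPt hℓ0 hNc' S.a₀_nonneg S.a₀_lt (S.t_nonneg hi) (S.t_lt i hi)).le
  -- the isolation hypotheses of the node certificate
  refine N.exists_node_crossings hHG (Q := fun a ↦ S.t i ≤ rotIdx Nc S.a₀ (cellIdx ((s : ℤ) + 1) ℓ (N.p a - x)) ∧
    rotIdx Nc S.a₀ (cellIdx ((s : ℤ) + 1) ℓ (N.p a - x)) ≤ S.t j) ?_ ?_ ?_ hw ?_ ?_
  · obtain ⟨a, ha, hat⟩ := hcomp' i hi
    exact ⟨a, ha, by rw [hat]; exact ⟨le_rfl, S.t_mono hij hj⟩⟩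
  · rw [← Nat.cast_le (α := ℤ), hrIn, hrOut]
    nlinarith
  · rw [← Nat.cast_le (α := ℤ)]
    push_cast
    rw [hrOut]
    exact hRs
  · intro a ha hQ
    obtain ⟨m, hm, hmt⟩ := hcomp a ha
    rw [hmt] at hQ
    have him : i ≤ m := CellSkeleton.le_of_t_le hi hQ.1
    have hmj : m ≤ j := CellSkeleton.le_of_t_le hm hQ.2
    have h := S.zNorm_sub_center_lt hℓ0 hR hNc hNc' (N.zNorm_p_sub ha) him hmj hj hmt
    rw [hrIn]
    simp only [CellSkeleton.nodeCenter]
    rw [show N.p a - (x + idxPt ((s : ℤ) + 1) (ℓ : ℤ) Nc S.a₀ (S.t i)) =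
      N.p a - x - idxPt ((s : ℤ) + 1) (ℓ : ℤ) Nc S.a₀ (S.t i) by abel]
    nlinarith
  · intro a ha hQ
    obtain ⟨m, hm, hmt⟩ := hcomp a ha
    rw [hmt] at hQ
    have hout : m < i ∨ j < m := by
      by_contra hh
      exact hQ ⟨S.t_mono (show i ≤ m by omega) hm, S.t_mono (show m ≤ j by omega) hj⟩
    have hroot : ¬ (i = 0 ∧ j = S.n - 1) := fun h ↦ by rcases hout with h' | h' <;> omega
    have h := S.le_two_mul_zNorm_sub_center Groot hℓ0 hR hNc hNc' (N.zNorm_p_sub ha) hij (by omega) hroot hm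
      hout hmt
    rw [hrOut]
    simp only [CellSkeleton.nodeCenter]
    rw [show N.p a - (x + idxPt ((s : ℤ) + 1) (ℓ : ℤ) Nc S.a₀ (S.t i)) =
      N.p a - x - idxPt ((s : ℤ) + 1) (ℓ : ℤ) Nc S.a₀ (S.t i) by abel]
    have hG3 : 3 ≤ G / 8 := by nlinarith
    have hG24 : 24 ≤ G := by omega
    nlinarith

/-- **The node annulus lies in the big ball** `Λ_{2s}(x)` (outer radius `≤ s - 1`). -/
theorem nodeAnnulus_subset (hℓ : 1 ≤ ℓ) (hNc' : (Nc - 1) * (ℓ : ℤ) < 8 * ((s : ℤ) + 1)) (Groot : ℤ) {i j : ℕ}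
    (hi : i < S.n) (hRs : (CellSkeleton.nodeROut ℓ (S.gapOutZ Groot i j) : ℕ) + 1 ≤ s) :
    zAnn (S.nodeCenter ((s : ℤ) + 1) ℓ x i) (S.nodeRIn ℓ i j) (CellSkeleton.nodeROut ℓ (S.gapOutZ Groot i j)) ⊆
      zBall x (2 * s) := by
  have hℓ0 : (0 : ℤ) < ℓ := by exact_mod_cast hℓ
  refine zAnn_subset_zBall_of_le ?_ hRs
  simp only [CellSkeleton.nodeCenter, add_sub_cancel_left]
  exact (zNorm_idxPt hℓ0 hNc' S.a₀_nonneg S.a₀_lt (S.t_nonneg hi) (S.t_lt i hi)).le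

end Necklace

/-- **Crossings of the node annuli of a necklace skeleton (registered helper, anchor of this module on the crux
item)**: for a cell skeleton compatible with a necklace, a weakly good index interval `[i, j]` (outer radius `≤ s - 1`)
has an annulus `zAnn (nodeCenter i) (nodeRIn i j) (nodeROut G)` carrying two open crossings not joined inside it
(`Necklace.node_crossings`, which also returns the first run and the crossing clusters). -/
theorem necklace_node_annulus_crossings : ∀ (ℓ lam s : ℕ) (x : Site 2) (ω : BondConfig (Site 2)) (N : Necklace ω ℓ lam s x) (Nc : ℤ) (S : NeckCoarseZ2.CellSkeleton Nc) (Groot : ℤ) (i j : ℕ), (∀ a b, (openGraph ω).Adj a b → (zdGraph 2).Adj a b) → 1 ≤ ℓ → 8 * ((s : ℤ) + 1) ≤ Nc * ℓ → (Nc - 1) * (ℓ : ℤ) < 8 * ((s : ℤ) + 1) → (∀ a < N.k, ∃ m < S.n, NeckCoarseZ2.rotIdx Nc S.a₀ (NeckCoarseZ2.cellIdx ((s : ℤ) + 1) ℓ (N.p a - x)) = S.t m) → (∀ m < S.n, ∃ a < N.k, NeckCoarseZ2.rotIdx Nc S.a₀ (NeckCoarseZ2.cellIdx ((s : ℤ)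 + 1) ℓ (N.p a - x)) = S.t m) → i ≤ j → j < S.n → 2 * (S.t j - S.t i) + 3 ≤ S.gapOutZ Groot i j / 8 → (ℓ : ℤ) * (S.gapOutZ Groot i j / 8) + 1 ≤ s → ∃ p₁ q₁ p₂ q₂, zNorm (p₁ - S.nodeCenter ((s : ℤ) + 1) ℓ x i) = S.nodeRIn ℓ i j ∧ zNorm (q₁ - S.nodeCenter ((s : ℤ) + 1) ℓ x i) = CellSkeleton.nodeROut ℓ (S.gapOutZ Groot i j) ∧ zNorm (p₂ - S.nodeCenter ((s : ℤ) + 1) ℓ x i) = S.nodeRIn ℓ i j ∧ zNorm (q₂ - S.nodeCenter ((s : ℤ) + 1) ℓ x i) = CellSkeleton.nodeROut ℓ (S.gapOutZ Groot i j) ∧ PathIn (openGraph ω) (NeckCoarseZ2.zAnn (S.nodeCenter ((s : ℤ) + 1) ℓ x i) (S.nodeRIn ℓ i j) (CellSkeleton.nodeROut ℓ (S.gapOutZ Groot i j))) p₁ q₁ ∧ PathIn (openGraph ω) (NeckCoarseZ2.zAnn (S.nodeCenter ((s : ℤ) + 1) ℓ x i) (S.nodeRIn ℓ i j) (CellSkeleton.nodeROut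 ℓ (S.gapOutZ Groot i j))) p₂ q₂ ∧ ¬ PathIn (openGraph ω) (NeckCoarseZ2.zAnn (S.nodeCenter ((s : ℤ) + 1) ℓ x i) (S.nodeRIn ℓ i j) (CellSkeleton.nodeROut ℓ (S.gapOutZ Groot i j))) p₁ p₂ :=
  fun _ _ _ _ _ N _ S Groot _ _ hHG hℓ hNc hNc' hcomp hcomp' hij hj hgood hRs ↦ by
    obtain ⟨_, _, p₁, q₁, p₂, q₂, -, -, -, -, -, h1, h2, h3, h4, h5, h6, h7, -, -⟩ :=
      N.node_crossings S hHG hℓ hNc hNc' hcomp hcomp' Groot hij hj hgood hRs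
    exact ⟨p₁, q₁, p₂, q₂, h1, h2, h3, h4, h5, h6, h7⟩

end Summit.CriticalPhenomena.CardyFormulaZ2.Cruxes.NestingRigidity.PinchResampling

end
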